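import Summits.NavierStokesRegularity.FunctionalMining.StretchingLaminateBetchov
import Mathlib.LinearAlgebra.Matrix.Notation
import Mathlib.Data.Matrix.Mul
import Mathlib.Tactic.LinearCombination
import Mathlib.Tactic.Linarith
import HarnessLib

/-!
# FunctionalMining — K1-Q1 laminates: the MARTINGALE STRUCTURE of div-free lamination trees (`G²` and `Sω` are martingales; `σ` is quadratic along every layer) — dict seat, staged

Search for candidate a priori estimates; no regularity claim.

Cell `pub-nsfunc`, dict seat (gen 11), STAGED for the prove seat (target tree path
`Summits/NavierStokesRegularity/FunctionalMining/StretchingLaminateMartingale.lean`; file AFTER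
`StretchingLaminateBetchov.lean` (dict (an)), whose generic leaf functional `Laminate.Tree.leafSum` and
MARTINGALE PRINCIPLE `Laminate.Tree.leafSum_eq_of_split` it reuses). Typed question K1-Q1, laminate lane
(`HOME/DICTIONARY.md` §14; `HOME/pub-nsfunc-dict/K1Q1-LADDER.md` §B; bank seat
`HOME/pub-nsfunc-bank/K1Q1-LAMINATE-BURKHOLDER.md` §1 and §5, THEOREM L-CAP-B).

WHAT THIS FILE TYPES. The bank seat's Burkholder transplant (THEOREM L-CAP-B, `C_lam ≤ 0.91` at PAPER +
exact-certificate level, NOT kernel) rests on a DICTIONARY between div-free lamination trees and martingale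
pairs: along a div-free layer `B = c ⊗ n` (`c·n = 0`) the vorticity moves by `t·w`, `w = n × c`
(`StretchingLaminateCalculus`: `vort*_layer`), the strain by `t·sym B` with `2|sym B|_F² = |w|²`, and — the
two structural facts recorded in §5 of the bank file as the input of any "production-aware" sharpening —
(M1) **`G²` is a MATRIX martingale** (`(c ⊗ n)² = (c·n)(c ⊗ n) = 0`), in particular
(M2) **`S_G ω_G` is a VECTOR martingale** (unconditionally in `c, n`: `sym(c ⊗ n)(n × c) = 0`), and
(M3) **the production `σ = ωᵀSω` is QUADRATIC along every layer**, with linear coefficient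
`2 w·(S_G ω_G) + (ω·c)(ω·n)` and second coefficient `wᵀ S_G w` (NO cubic term — the layer's strain annihilates
its own vorticity, `quadS_layer_self`). This file puts (M1)–(M3) and the isometry defect
`2|sym(c ⊗ n)|_F² − |n × c|² = 2(c·n)²` in the kernel, in the exact rational tree calculus of
`StretchingLaminates` / `StretchingLaminateCalculus` / `StretchingLaminateBetchov`. Every statement is an
exact polynomial identity (`ring`) or an instance of the martingale principle on VALID trees.

THEOREMS.
* `Grad.toMatrix_layer : (G.layer t s).toMatrix = G.toMatrix + t • (c ⊗ n)`;
  `Split.vecMulVec_sq : (c ⊗ n)² = (c·n) • (c ⊗ n)`;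
  `Grad.sq_split` (M1 at one split, remainder `λ(1−λ)(c·n) • c ⊗ n`), `Grad.sq_split_apply` (entrywise);
  `Tree.leafSum_sq (valid 𝒯) : Σ_L W_L (G_L²)ᵢⱼ = W (G²)ᵢⱼ` and `Tree.leafSum_sq_root : Σ_L W_L (G_L²)ᵢⱼ = 0`.
* `Grad.sv0/sv1/sv2 = (S_G ω_G)ᵢ`; `Grad.stretch_eq_vort_sv : σ(G) = ω · (Sω)`;
  `Grad.sv*_split` (M2 at one split, NO remainder), `Tree.leafSum_sv* (valid 𝒯) : Σ_L W_L (Sω)_L = W (Sω)(G)`,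
  `Tree.leafSum_sv*_root : Σ_L W_L (S_L ω_L)ᵢ = 0`.
* `Grad.stretchLin`, `Grad.stretch_layer : σ(G + tB) = σ(G) + t·stretchLin G s + t²·wᵀS_G w` (M3);
  `Split.two_symSq_sub_wSq : 2|sym(c ⊗ n)|_F² − |w|² = 2(c·n)²` (the dictionary isometry `|dy| = |dx|` on
  div-free layers, `y = √2 S`, `x = ω`).

HONEST SIZE. Exact algebra of the laminate METHOD; no bound on `C_lam` or `C⋆` is proved here, and nothing is
a statement about Navier–Stokes solutions. The Burkholder step of L-CAP-B (a published sharp martingale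
inequality) is NOT in this file and, when typed, lives in `Literature/` as a NAMED FACT used as a hypothesis;
the bank certificate is one-party at the time of writing.
-/

namespace Summit.NavierStokesRegularity.FunctionalMining

namespace Laminate

/-! ## 1. Matrix form of a state and of a layer -/

namespace Grad

/-- The state as a `3 × 3` rational matrix `G i j = ∂ⱼ uᵢ`. [ours; bookkeeping] -/
def toMatrix (G : Grad) : Matrix (Fin 3) (Fin 3) ℚ :=
  !![G.g00, G.g01, G.g02; G.g10, G.g11, G.g12; G.g20, G.g21, G.g22]

end Grad

namespace Split

/-- The amplitude vector `c` of a split. [ours; bookkeeping] -/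
def cVec (s : Split) : Fin 3 → ℚ := ![s.c0, s.c1, s.c2]

/-- The layering normal `n` of a split. [ours; bookkeeping] -/
def nVec (s : Split) : Fin 3 → ℚ := ![s.n0, s.n1, s.n2]

/-- **Rank-one layers are `(c·n)`-nilpotent**: `(c ⊗ n)² = (c·n) • (c ⊗ n)`; on a div-free split `(c ⊗ n)² = 0`.
[ours; elementary] -/
theorem vecMulVec_sq (s : Split) :
    Matrix.vecMulVec s.cVec s.nVec * Matrix.vecMulVec s.cVec s.nVec = s.dot • Matrix.vecMulVec s.cVec s.nVec := by
  ext i j; fin_cases i <;> fin_cases j <;>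
    simp [Matrix.mul_apply, Fin.sum_univ_three, cVec, nVec, dot] <;> ring

/-- **Isometry defect of the dictionary**: `2|sym(c ⊗ n)|_F² − |n × c|² = 2(c·n)²`; on a div-free split the
strain increment `√2·sym B` and the vorticity increment `w = n × c` have the same length (`|dy| = |dx|`).
Search for candidate a priori estimates; no regularity claim. [ours; elementary] -/
theorem two_symSq_sub_wSq (s : Split) :
    2 * (Grad.zero.layer 1 s).sSq - s.wSq = 2 * s.dot ^ 2 := by
  simp only [Grad.sSq, Grad.layer, Grad.zero, wSq, w0, w1, w2, dot]; ring

end Split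

namespace Grad

/-- Adding a layer is adding `t • c ⊗ n` as matrices. [ours; bookkeeping] -/
theorem toMatrix_layer (G : Grad) (t : ℚ) (s : Split) :
    (G.layer t s).toMatrix = G.toMatrix + t • Matrix.vecMulVec s.cVec s.nVec := by
  ext i j; fin_cases i <;> fin_cases j <;> simp [toMatrix, layer, Split.cVec, Split.nVec] <;> ring

/-! ## 2. (M1) `G²` is a matrix martingale on div-free trees -/

/-- **(M1) at one split**: `λ·(G₊)² + (1−λ)·(G₋)² = G² + λ(1−λ)(c·n) • (c ⊗ n)` for the children
`G₊ = G + (1−λ)B`, `G₋ = G − λB`; the remainder vanishes on a div-free split. [ours; elementary] -/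
theorem sq_split (G : Grad) (s : Split) :
    s.lam • ((G.layer (1 - s.lam) s).toMatrix * (G.layer (1 - s.lam) s).toMatrix)
      + (1 - s.lam) • ((G.layer (-s.lam) s).toMatrix * (G.layer (-s.lam) s).toMatrix)
      = G.toMatrix * G.toMatrix + (s.lam * (1 - s.lam) * s.dot) • Matrix.vecMulVec s.cVec s.nVec := by
  ext i j; fin_cases i <;> fin_cases j <;>
    simp [toMatrix, layer, Split.cVec, Split.nVec, Split.dot] <;> ring

/-- (M1) entrywise, in the shape consumed by the martingale principle `Tree.leafSum_eq_of_split`.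
[ours; elementary] -/
theorem sq_split_apply (G : Grad) (s : Split) (i j : Fin 3) :
    s.lam * ((G.layer (1 - s.lam) s).toMatrix * (G.layer (1 - s.lam) s).toMatrix) i j
      + (1 - s.lam) * ((G.layer (-s.lam) s).toMatrix * (G.layer (-s.lam) s).toMatrix) i j
      = (G.toMatrix * G.toMatrix) i j + s.dot * (s.lam * (1 - s.lam) * (s.cVec i * s.nVec j)) := by
  have h := congrFun (congrFun (sq_split G s) i) j
  simp only [Matrix.add_apply, Matrix.smul_apply, smul_eq_mul, Matrix.vecMulVec_apply] at h
  linear_combination h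

end Grad

namespace Tree

/-- **(M1) `G²` is a matrix martingale**: on a VALID tree, `Σ_L W_L (G_L²)ᵢⱼ = W·(G²)ᵢⱼ` below any node in
state `G` with weight `W`. Search for candidate a priori estimates; no regularity claim. [ours; elementary] -/
theorem leafSum_sq (T : Tree) (hT : T.valid = true) (i j : Fin 3) :
    ∀ (G : Grad) (W : ℚ), T.leafSum (fun G => (G.toMatrix * G.toMatrix) i j) G W = W * (G.toMatrix * G.toMatrix) i j :=
  leafSum_eq_of_split (fun G => (G.toMatrix * G.toMatrix) i j)
    (fun _ s => s.lam * (1 - s.lam) * (s.cVec i * s.nVec j)) (fun G s => Grad.sq_split_apply G s i j) T hT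

/-- (M1) at the root: `Σ_L W_L (G_L²)ᵢⱼ = 0` for every valid tree (state `0`, weight `1`). [ours; elementary] -/
theorem leafSum_sq_root (T : Tree) (hT : T.valid = true) (i j : Fin 3) :
    T.leafSum (fun G => (G.toMatrix * G.toMatrix) i j) Grad.zero 1 = 0 := by
  rw [leafSum_sq T hT i j Grad.zero 1]
  fin_cases i <;> fin_cases j <;> simp [Grad.toMatrix, Grad.zero, Matrix.mul_apply, Fin.sum_univ_three]

end Tree

/-! ## 3. (M2) `S_G ω_G` is a vector martingale (unconditionally in `c, n`) -/

namespace Grad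

/-- `(S_G ω_G)₀` with `S_G = (G + Gᵀ)/2`. [ours; bookkeeping] -/
def sv0 (G : Grad) : ℚ := G.g00 * G.vort0 + (G.g01 + G.g10) / 2 * G.vort1 + (G.g02 + G.g20) / 2 * G.vort2

/-- `(S_G ω_G)₁`. [ours; bookkeeping] -/
def sv1 (G : Grad) : ℚ := (G.g01 + G.g10) / 2 * G.vort0 + G.g11 * G.vort1 + (G.g12 + G.g21) / 2 * G.vort2

/-- `(S_G ω_G)₂`. [ours; bookkeeping] -/
def sv2 (G : Grad) : ℚ := (G.g02 + G.g20) / 2 * G.vort0 + (G.g12 + G.g21) / 2 * G.vort1 + G.g22 * G.vort2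

/-- `σ(G) = ω · (S_G ω)`. [ours; bookkeeping] -/
theorem stretch_eq_vort_sv (G : Grad) : G.stretch = G.vort0 * G.sv0 + G.vort1 * G.sv1 + G.vort2 * G.sv2 := by
  simp only [stretch, sv0, sv1, sv2]; ring

/-- **(M2) at one split, component 0**: `λ(Sω)(G₊)₀ + (1−λ)(Sω)(G₋)₀ = (Sω)(G)₀` — NO remainder, for ALL
`c, n` (the quadratic term is `sym(c ⊗ n)(n × c) = 0`). [ours; elementary] -/
theorem sv0_split (G : Grad) (s : Split) :
    s.lam * (G.layer (1 - s.lam) s).sv0 + (1 - s.lam) * (G.layer (-s.lam) s).sv0 = G.sv0 := by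
  simp only [sv0, layer, vort0, vort1, vort2]; ring

/-- (M2) at one split, component 1. [ours; elementary] -/
theorem sv1_split (G : Grad) (s : Split) :
    s.lam * (G.layer (1 - s.lam) s).sv1 + (1 - s.lam) * (G.layer (-s.lam) s).sv1 = G.sv1 := by
  simp only [sv1, layer, vort0, vort1, vort2]; ring

/-- (M2) at one split, component 2. [ours; elementary] -/
theorem sv2_split (G : Grad) (s : Split) :
    s.lam * (G.layer (1 - s.lam) s).sv2 + (1 - s.lam) * (G.layer (-s.lam) s).sv2 = G.sv2 := by
  simp only [sv2, layer, vort0, vort1, vort2]; ring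

end Grad

namespace Tree

/-- **(M2) component 0**: `Σ_L W_L (S_L ω_L)₀ = W·(S_G ω_G)₀` on every valid tree. Search for candidate a
priori estimates; no regularity claim. [ours; elementary] -/
theorem leafSum_sv0 (T : Tree) (hT : T.valid = true) :
    ∀ (G : Grad) (W : ℚ), T.leafSum Grad.sv0 G W = W * G.sv0 :=
  leafSum_eq_of_split Grad.sv0 (fun _ _ => 0) (fun G s => by rw [Grad.sv0_split]; ring) T hT

/-- (M2) component 1. [ours; elementary] -/
theorem leafSum_sv1 (T : Tree) (hT : T.valid = true) :
    ∀ (G : Grad) (W : ℚ), T.leafSum Grad.sv1 G W = W * G.sv1 :=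
  leafSum_eq_of_split Grad.sv1 (fun _ _ => 0) (fun G s => by rw [Grad.sv1_split]; ring) T hT

/-- (M2) component 2. [ours; elementary] -/
theorem leafSum_sv2 (T : Tree) (hT : T.valid = true) :
    ∀ (G : Grad) (W : ℚ), T.leafSum Grad.sv2 G W = W * G.sv2 :=
  leafSum_eq_of_split Grad.sv2 (fun _ _ => 0) (fun G s => by rw [Grad.sv2_split]; ring) T hT

/-- **(M2) at the root: the leaf stretching VECTORS average to zero**, `Σ_L W_L S_L ω_L = 0`, on every valid
tree — although the leaf PRODUCTIONS `ω_L·S_L ω_L` need not (`σ(𝒯) = Σ_L W_L ω_L·S_L ω_L` is what the laminate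
constant maximises). Search for candidate a priori estimates; no regularity claim. [ours; elementary] -/
theorem leafSum_sv_root (T : Tree) (hT : T.valid = true) :
    T.leafSum Grad.sv0 Grad.zero 1 = 0 ∧ T.leafSum Grad.sv1 Grad.zero 1 = 0 ∧ T.leafSum Grad.sv2 Grad.zero 1 = 0 := by
  refine ⟨?_, ?_, ?_⟩
  · rw [leafSum_sv0 T hT]; simp [Grad.sv0, Grad.zero, Grad.vort0, Grad.vort1, Grad.vort2]
  · rw [leafSum_sv1 T hT]; simp [Grad.sv1, Grad.zero, Grad.vort0, Grad.vort1, Grad.vort2]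
  · rw [leafSum_sv2 T hT]; simp [Grad.sv2, Grad.zero, Grad.vort0, Grad.vort1, Grad.vort2]

end Tree

/-! ## 4. (M3) the production is quadratic along every layer -/

namespace Grad

/-- The LINEAR coefficient of `σ` along the layer `G + t·c ⊗ n`: `2 w·(S_G ω_G) + (ω·c)(ω·n)`.
[ours; bookkeeping] -/
def stretchLin (G : Grad) (s : Split) : ℚ :=
  2 * (s.w0 * G.sv0 + s.w1 * G.sv1 + s.w2 * G.sv2)
    + (G.vort0 * s.c0 + G.vort1 * s.c1 + G.vort2 * s.c2) * (G.vort0 * s.n0 + G.vort1 * s.n1 + G.vort2 * s.n2)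

/-- **(M3) `σ` is QUADRATIC along every layer**: `σ(G + tB) = σ(G) + t·stretchLin G s + t²·wᵀ S_G w` for ALL
`c, n, t` — the cubic coefficient `wᵀ sym(c ⊗ n) w` vanishes identically (`quadS_layer_self`), and the second
difference `p'' = 2 wᵀ S_G w` is the created production of `stretch_split`. Search for candidate a priori
estimates; no regularity claim. [ours; elementary] -/
theorem stretch_layer (G : Grad) (t : ℚ) (s : Split) :
    (G.layer t s).stretch = G.stretch + t * G.stretchLin s + t ^ 2 * G.quadS s.w0 s.w1 s.w2 := by
  simp only [stretch, layer, vort0, vort1, vort2, stretchLin, sv0, sv1, sv2, quadS, Split.w0, Split.w1, Split.w2]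
  ring

/-- Consistency with `stretch_split`: averaging (M3) over the two children kills the linear term and leaves the
created production `λ(1−λ)·wᵀ S_G w` (a re-derivation of the tree's `stretch_split` from (M3); `example`-style, kept
private). [ours; bookkeeping] -/
private theorem stretch_split' (G : Grad) (s : Split) :
    s.lam * (G.layer (1 - s.lam) s).stretch + (1 - s.lam) * (G.layer (-s.lam) s).stretch
      = G.stretch + s.lam * (1 - s.lam) * G.quadS s.w0 s.w1 s.w2 := by
  rw [stretch_layer, stretch_layer]; ring

end Grad

/-! ## 5. Sanity evaluations on the tree's named examples (kernel `decide`) -/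

/-- On the `board` tree the root average of `(Sω)₀` is `0` (M2), evaluated. [ours; bookkeeping] -/
theorem board_sv0 : board.leafSum Grad.sv0 Grad.zero 1 = 0 := by decide +kernel

/-- On `treeD4` the root average of `(Sω)₂` is `0` (M2), evaluated. [ours; bookkeeping] -/
theorem treeD4_sv2 : treeD4.leafSum Grad.sv2 Grad.zero 1 = 0 := by decide +kernel

end Laminate

end Summit.NavierStokesRegularity.FunctionalMining
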